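import Mathlib
import Summits.ResolutionOfSingularities.ResolutionOfSingularities.Theorems.HomologicalConductorNoZenoBirthDefs
import Summits.ResolutionOfSingularities.ResolutionOfSingularities.Theorems.HomologicalConductorPersistenceSurfaceRationalAssembly
import Summits.ResolutionOfSingularities.ResolutionOfSingularities.Theorems.HomologicalConductorPersistencePeriodicSaturationLocal
import Summits.ResolutionOfSingularities.ResolutionOfSingularities.Theorems.HomologicalConductorPersistenceLocalisation

/-!
# tri-1 AUDIT of w44b-o9a/o9b/o9c (power-basis hypothesis vs the route's local stages) — CONSUMER SKETCH

[OURS · L1 w44b · res-L1-w44b-tri-1 g5; audit instrument, AI-written, weaker than expert review; NOT a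
statement of the manuscript under study.]  This file shows, farm-checked, what a consumer (o11 `Sat₄R`
assembly) gets from o9c at a tower stage `B ⊆ K`, and isolates the ONE hypothesis it must supply:
`IsMonicHypersurfaceLocalization k d ↥B` — the stage is ring-isomorphic to a localisation of
`k[x₁,…,x_d][X]/(f)`, `f` monic in `X`.  Everything else (transport of `ca`/`caⁿ` along `≃+*`, the
route's `let ca` / `let caAt` ↔ `cohomologyAnnihilator(OfDegree)`, monotonicity `ca³ ⊆ ca⁴`) is in the tree.
-/

set_option linter.dupNamespace false

open Literature.RingTheory.CohomologyAnnihilator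
open Summit.ResolutionOfSingularities.ResolutionOfSingularities.Theorems

namespace AuditO9

universe u

/-- B1 (transport): saturation `ca = caⁿ` is invariant under ring isomorphism (tree
`map_ringEquiv_cohomologyAnnihilator(OfDegree)`). -/
theorem cohomologyAnnihilator_eq_of_ringEquiv {R S : Type u} [CommRing R] [CommRing S]
    (e : R ≃+* S) (n : ℕ) (h : cohomologyAnnihilator S = cohomologyAnnihilatorOfDegree S n) :
    cohomologyAnnihilator R = cohomologyAnnihilatorOfDegree R n := by
  rw [← map_ringEquiv_cohomologyAnnihilator e.symm, ← map_ringEquiv_cohomologyAnnihilatorOfDegree e.symm n,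
    h]

/-- The consumer-side hypothesis: `T` is (ring-isomorphic to) a localisation of a MONIC relative
hypersurface `k[x₁,…,x_d][X]/(f)` over the polynomial ring in `d` variables. -/
def IsMonicHypersurfaceLocalization (k : Type u) [Field k] (d : ℕ) (T : Type u) [CommRing T] : Prop :=
  ∃ (f : Polynomial (MvPolynomial (Fin d) k)), f.Monic ∧
    ∃ U : Submonoid (AdjoinRoot f), Nonempty (T ≃+* Localization U)

/-- o9c + B1: `ca(T) = caᵈ⁺¹(T)` for every monic-hypersurface localisation `T`, any field, any char. -/
theorem cohomologyAnnihilator_eq_of_isMonicHypersurfaceLocalization {k : Type u} [Field k] {d : ℕ}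
    {T : Type u} [CommRing T] (h : IsMonicHypersurfaceLocalization k d T) :
    cohomologyAnnihilator T = cohomologyAnnihilatorOfDegree T (d + 1) := by
  obtain ⟨f, hf, U, ⟨e⟩⟩ := h
  exact cohomologyAnnihilator_eq_of_ringEquiv e (d + 1)
    (HomologicalConductor.PeriodicSaturationLocal.cohomologyAnnihilator_localization_adjoinRoot_mvPolynomial_eq
      k d hf U)

/-! ## Along the route's tower: the `Sat₄` column at a hypersurface stage -/

variable {k K : Type} [Field k] [Field K] [Algebra k K]

/-- **`Satₙ` at a monic-hypersurface stage, every `n ≥ d + 1`.** For a stage `B ⊆ K` of the route's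
tower with `IsMonicHypersurfaceLocalization k d ↥B`: the route's `ca B` lies in the route's `caAt n B`
for every `n ≥ d + 1` — with no recurrence hypothesis. -/
theorem ca_subset_caAt_of_isMonicHypersurfaceLocalization (B : Subalgebra k K) {d n : ℕ}
    (h : IsMonicHypersurfaceLocalization k d ↥B) (hdn : d + 1 ≤ n) :
    NoZeno.Birth.ca B ⊆ {x : K | ∃ hx : x ∈ B, ∀ i : ℕ, n ≤ i → ∀ (M N : ModuleCat.{0} ↥B),
      Module.Finite ↥B M → Module.Finite ↥B N →
        ∀ e : CategoryTheory.Abelian.Ext.{0} M N i, (⟨x, hx⟩ : ↥B) • e = 0} := by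
  intro x hx
  rw [NoZeno.Birth.mem_ca_iff] at hx
  obtain ⟨hxB, m, hm⟩ := hx
  rw [HomologicalConductor.PersistenceSurfaceRationalAssembly.mem_caAt_iff]
  refine ⟨hxB, ?_⟩
  have hca : (⟨x, hxB⟩ : ↥B) ∈ cohomologyAnnihilator ↥B :=
    mem_cohomologyAnnihilator_iff.mpr ⟨m, mem_cohomologyAnnihilatorOfDegree_iff.mpr hm⟩
  rw [cohomologyAnnihilator_eq_of_isMonicHypersurfaceLocalization h] at hca
  exact cohomologyAnnihilatorOfDegree_mono hdn hca

/-- The surface instance `d = 2`, `n = 4`: the `SaturationFourSurface` clause at a stage that is a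
monic-hypersurface localisation over `k[x,y]` (e.g. every RDP / `z^p + F(x,y)` specimen at stage 0). -/
theorem ca_subset_caAt_four_of_isMonicHypersurfaceLocalization_two (B : Subalgebra k K)
    (h : IsMonicHypersurfaceLocalization k 2 ↥B) :
    NoZeno.Birth.ca B ⊆ {x : K | ∃ hx : x ∈ B, ∀ i : ℕ, 4 ≤ i → ∀ (M N : ModuleCat.{0} ↥B),
      Module.Finite ↥B M → Module.Finite ↥B N →
        ∀ e : CategoryTheory.Abelian.Ext.{0} M N i, (⟨x, hx⟩ : ↥B) • e = 0} :=
  ca_subset_caAt_of_isMonicHypersurfaceLocalization B h (by norm_num)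

/-! ## Stage 0 of a specimen tower: `loc O A` for `A ≃+* k[x₁,…,x_d][X]/(f)` -/

open Summit.ResolutionOfSingularities.ResolutionOfSingularities.Theorems.SyzygyFlattening (locAt self_le_locAt)

/-- **Stage 0.** If the affine model `A ⊆ O` is ring-isomorphic to a monic relative hypersurface
`k[x₁,…,x_d][X]/(f)`, then stage `0` of the route's tower, `tower O A 0 = loc O A` (= tree `locAt O A`,
a localisation of `A`: `PersistenceLocalisation.isLocalization_locAt`), is a monic-hypersurface
localisation — so `Sat_{d+1}` holds there by o9c (previous theorem). -/
theorem isMonicHypersurfaceLocalization_loc (O : ValuationSubring K) (A : Subalgebra k K)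
    (hAO : A.toSubring ≤ O.toSubring) {d : ℕ} {f : Polynomial (MvPolynomial (Fin d) k)} (hf : f.Monic)
    (e : ↥A ≃+* AdjoinRoot f) :
    IsMonicHypersurfaceLocalization k d ↥(NoZeno.Birth.loc O A) := by
  letI : Algebra ↥A ↥(locAt O A) := (Subalgebra.inclusion (self_le_locAt O A)).toRingHom.toAlgebra
  let U : Submonoid ↥A :=
    (IsUnit.submonoid ↥(locAt O A)).comap (Subalgebra.inclusion (self_le_locAt O A)).toRingHom
  haveI : IsLocalization U ↥(locAt O A) :=
    HomologicalConductor.PersistenceLocalisation.isLocalization_locAt O A hAO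
  refine ⟨f, hf, U.map e.toMonoidHom, ⟨?_⟩⟩
  rw [NoZeno.Birth.loc_eq_locAt]
  exact IsLocalization.ringEquivOfRingEquiv (S := ↥(locAt O A)) (M := U)
    (T := U.map e.toMonoidHom) (Q := Localization (U.map e.toMonoidHom)) e rfl

/-- **Stage 0, surface case**: `ca (tower O A 0) ⊆ caAt 4 (tower O A 0)` for `A ≃+* k[x,y][X]/(f)`,
`f` monic — every RDP normal form and every `z^p + F(x,y)` specimen, every characteristic. -/
theorem ca_tower_zero_subset_caAt_four (O : ValuationSubring K) (A : Subalgebra k K)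
    (hAO : A.toSubring ≤ O.toSubring) {f : Polynomial (MvPolynomial (Fin 2) k)} (hf : f.Monic)
    (e : ↥A ≃+* AdjoinRoot f) :
    NoZeno.Birth.ca (NoZeno.Birth.tower O A 0) ⊆ {x : K | ∃ hx : x ∈ NoZeno.Birth.tower O A 0,
      ∀ i : ℕ, 4 ≤ i → ∀ (M N : ModuleCat.{0} ↥(NoZeno.Birth.tower O A 0)),
      Module.Finite ↥(NoZeno.Birth.tower O A 0) M → Module.Finite ↥(NoZeno.Birth.tower O A 0) N →
        ∀ e : CategoryTheory.Abelian.Ext.{0} M N i, (⟨x, hx⟩ : ↥(NoZeno.Birth.tower O A 0)) • e = 0} := by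
  rw [NoZeno.Birth.tower_zero]
  exact ca_subset_caAt_four_of_isMonicHypersurfaceLocalization_two _
    (isMonicHypersurfaceLocalization_loc O A hAO hf e)

/-! ## B2 (geometric bridge, NOT in tree): abstract hypersurface stage ⇒ monic-hypersurface localisation.
Typed target only (sorried): a local domain essentially of finite type over an infinite field `k`, of
Krull dimension `d`, with `k`-rational closed point and maximal ideal generated by `≤ d + 1` elements,
is a monic-hypersurface localisation over `k[x₁,…,x_d]` (generic finite linear projection to `𝔸^{d+1}`,
unramified and injective at the point, + Nakayama + UFD; then Nagata's change of variables makes the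
equation monic). -/
theorem isMonicHypersurfaceLocalization_of_spanRank_le (k : Type u) [Field k] [Infinite k] (d : ℕ)
    (T : Type u) [CommRing T] [IsDomain T] [IsLocalRing T] [Algebra k T]
    [Algebra.EssFiniteType k T] (hdim : ringKrullDim T = d)
    (hedim : (IsLocalRing.maximalIdeal T).spanRank ≤ d + 1)
    (hres : Function.Bijective (algebraMap k (IsLocalRing.ResidueField T))) :
    IsMonicHypersurfaceLocalization k d T := by
  sorry

end AuditO9
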